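import Summits.QuantumFields.YangMills.Theorems.BalabanUVNodesN15SiteLayerBgPerturbedForm
import Summits.QuantumFields.YangMills.Theorems.BalabanUVNodesN15FullPropagatorExactUnitSocket

/-!
# Route «BalabanUVNodes», cluster K4 «SpineRates» — node N15 = NE2: THE SITE LAYER WITH THE BACKGROUND LIVE IN THE TwoGrid ENTRY CURRENCY, II — THE SITE SOCKET
# (`NE2PlusSite` BY NAME for the perturbed genuine site kernel `(Q′G′²Q′* + P(U))⁻¹` from the perturbations' letters ALONE) AND THE KNIT `N15At` WITH EVERY LAYER READING `U`

Cell `pub-ymgap`, WIDTH SEAT `pub-ymgap-dag-n15-w1` (generation 0; director-ym №197 ∕ HUMAN RULING D-0149; chair R455 (A) ∕ R461; plan g77 `W-SEAT-START-LIST.md` §2 n15 ITEM 1 —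
bus CLAIM pub-ymgap INBOX l.24149).  `bears_on: R4∕N15 · K3⁷ SpineGivenEndpointR13SepCoPH (stmt-QuantumFields-20544)`.  Filed `--kind proof --supports stmt-QuantumFields-20544
--as helper` — COUNT-NEUTRAL.  Two data `def`s (`siteEx`, the site kernel `tgSiteExOn`), the rest theorems; 0 `sorry`.  Imports this seat's part I `…N15SiteLayerBgPerturbedForm` (the
engine `abs_inv_add_sub_inv_add_le_of_coercive`, the letter block `siteForm_letters_family`) and dag-n15-a V-F `…N15FullPropagatorExactUnitSocket` (`tgCovExOn`,
`ne2PlusUnit_tgCovExOn_of_letters`; through it part 78 `tgSiteOn`, dag-n15-c G1 `genuineSiteStep`, `etaRateIneqSite_opGeo_unit`); nothing in the tree is modified.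

WHY.  V-F's knit `n15At_tgEx_of_ne2PlusOperator` reads the configuration in the OPERATOR layer (the hypothesis `hop`) and in the UNIT layer (the exactly dressed (2.156) covariance
through the middle factors' letters `hZ`), but NOT in the SITE layer (`tgSiteOn`: the genuine `U ≡ 1` kernel re-based, configuration dropped).  The print's site object at a
background is the DRESSED SITE KERNEL `(Q′(U)G′²(U)Q′*(U))⁻¹` ([Balaban1985BackgroundPropagators] Thm 3.2 (3.48) p. 398), obtained from the `U`-form by a small decaying
perturbation `C(A)` and inversion ((3.65)–(3.67) p. 403).  THIS FILE abstracts exactly that, in V-F's currency: for ANY family `pi i = ⟨tgGeoC (ι i), gf i, Bc i, Bf i, pair i⟩` and ANY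
site-perturbation maps `Pf i : (Bf i).Cfg → sites × sites` (fine run), `Pc i : (Bc i).Cfg → sites × sites` (coarse run) carrying THREE LETTERS (`|Pc(Ū)|, |Pf(U)| ≤ ζα₀e^{−δ_Pt}`,
`|Pf(U) − Pc(Ū)| ≤ τ(L^k)^{−γ_P}e^{−δ_Pt}` under (3.35)), the η-difference of the perturbed genuine site kernels of the two runs satisfies `NE2PlusSite` BY NAME; with V-F's unit socket and
an operator layer BY NAME this is `N15At` with EVERY layer reading `U`.  An INSTANCE = a site-perturbation species of (3.65)-shape (`F₂X²(Q* + F₂*) + QX²F₂* + Q(XE + EG)Q*`,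
dag-n15-c S2 `siteForm_sub_siteForm₀`) with its letters proved from (3.35) — a successor file (any pen's); none is constructed here.

CONTENTS.  §3 SOCKET: def `siteEx n a M P := (Q′G′²Q′*_{n,a} + P)⁻¹` on the coarse index `Idx M`; `siteEx_zero` (`P = 0` ⟹ `= kerRe`, b05 `qggqRe_inv`); def ★ `tgSiteExOn` (fine run's
`siteEx (L^mL^k) a_{k+m} (Pf i U)` minus coarse run's `siteEx (L^k) a_k (Pc i (avg U))` at `torIdx y, torIdx y′`); `tgSiteExOn_ker`; ★ `tgSiteExOn_of_zero` (both perturbations vanish ⟹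
part 78's `tgSiteOn`: the socket DEFORMS the U-blind layer); ★★★ **`ne2PlusSite_tgSiteExOn_of_letters`** — guard scales `(gf i).M ≥ 1`, exponent `γ_P > 0`, the letters as ONE hypothesis
`hP` ⟹ `NE2PlusSite d′ p c₃₅ pi (tgSiteExOn …)` with `(M₅, δ, a₀, C, γ) = (1, κ₁∕2, min a₁ (γ₀∕(4ζV₁)), (4∕γ₀)(C_r + τ)(4∕γ₀)V₂², min ¼ γ_P)` — a smallness in `α₀` ALONE, NO weight
window, NO Neumann series; `siteLetters_zero` (A6: the zero perturbations inhabit `hP` — and give back part 78's layer), `ne2PlusSite_tgSiteExOn_zero`.  §4 KNIT: ★★★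
**`n15At_tgExEx_of_ne2PlusOperator`** — `NE2PlusOperator c₃₅ pi Kop` BY NAME + V-F's unit letters `hZ` + the site letters `hP` ⟹ `N15At ⟨I, c₃₅, p, pi, Kop, tgSiteExOn …, tgCovExOn …,
⊤, dist⟩.  §5 `s_N15_of_admits_tgExEx_of_ne2PlusOperator` — the knit at ANY keyed rate home (dag-n15-a part 30's interface), hence at the ₁₃ CoPH homes by their certificates.

HONEST FRAMING.  Count-neutral SOCKET (kernel bookkeeping + part I ∕ V-F ∕ G1 ∕ b05 by name); the letters `hP`, `hZ` and the operator layer `hop` are HYPOTHESES here; wherever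
instantiated by a model species the result is MODEL-LEVEL ([B5]'s scalar `Q′, G′` at King's couplings on the unit tori `2L^{m_T}`, the genuine `U ≡ 1` site form; the background
enters only through the perturbation letters).  VACUITY (A3): `NE2PlusSite` opens with `∃ M₅, ∀ i, M₅ ≤ (gf i).M → …`, so on a family with BOUNDED `gf.M` (e.g. `gf.M ≡ 1`) the
STATEMENT also has a trivial proof (`M₅ := sup M + 1`; ref-B READ-686, dag-n15-a l.≈24335); the proof here takes `M₅ = 1` and is contentful exactly on `M`-live families, which plug
in unchanged (`hM : 1 ≤ (gf i).M`).  NOT [B9] Thm 3.2 at a general (3.35)-regular `U` (NE2⁺ NOT PRINTED as an η-rate); Node 00's [B9] layers of record are residual —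
**N15 is NOT discharged** (typed 28∕28 · discharged 5∕27 of record unchanged); one finite four-torus programme at fixed `ε` — NOT ℝ⁴, NOT infinite volume, NOT OS, NOT a mass gap,
NOT Clay; R4 closes the conditional finite-𝕋⁴ rung `BalabanLadder.UV` only.  Restate-immune (no Theses import).
-/

set_option autoImplicit false

noncomputable section

open scoped BigOperators Matrix
open Finset

namespace Summit.QuantumFields.YangMills.BalabanUVNodes.N15.SiteLayerBg
open Literature.MathematicalPhysics.QuantumFieldTheory.Balaban1983to89
open Literature.MathematicalPhysics.QuantumFieldTheory.Balaban1983to89.QGQInverse (Coercive)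
open Literature.MathematicalPhysics.QuantumFieldTheory.King1986 (exp_decay_mono)

/-! ## §3 ★★★ The socket: the perturbed genuine site kernel on the TwoGrid family, `NE2PlusSite` BY NAME from the perturbations' letters ALONE -/

section Socket

open Literature.MathematicalPhysics.QuantumFieldTheory.Balaban1983to89.T4EtaRate (PairedInstance EtaPairing NE2PlusOperator NE2PlusSite NE2PlusUnit EtaRateIneqSite)
open Literature.MathematicalPhysics.QuantumFieldTheory.Balaban1983to89.T4EtaRateDefect (rateWeight)
open Literature.MathematicalPhysics.QuantumFieldTheory.Balaban1983to89.B5Prop11Plancherel (Tor fine)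
open Literature.MathematicalPhysics.QuantumFieldTheory.Balaban1983to89.B4Sect5Torus (tdist tdist_nonneg tdist_symm tdist_triangle tdist_self torusSum_le)
open Literature.MathematicalPhysics.QuantumFieldTheory.Balaban1983to89.B4Sect5Proof (latticeConst latticeConst_nonneg)
open Literature.MathematicalPhysics.QuantumFieldTheory.Balaban1983to89.B5QGGQ145Bounds (Idx kerRe qggqRe qggqRe_inv)
open Literature.MathematicalPhysics.QuantumFieldTheory.Balaban1983to89.B5PBridgeProjection (torIdx)
open Literature.MathematicalPhysics.QuantumFieldTheory.Balaban1983to89.B6Lemma24Torus (pbox)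
open Literature.MathematicalPhysics.QuantumFieldTheory.Balaban1983to89.B6BondEliminationTorus (pdist)
open Literature.MathematicalPhysics.QuantumFieldTheory.Balaban1983to89.B6Cov2156Torus (one_le_M)
open Literature.MathematicalPhysics.QuantumFieldTheory.Balaban1983to89.B6UnitTorusCarrier (unitTorusGeo unitTorusGeo_len)
open Literature.MathematicalPhysics.QuantumFieldTheory.King1986 (aK aK_pos)
open Literature.MathematicalPhysics.QuantumFieldTheory.King1986.Torus (tdistT)
open Summit.QuantumFields.YangMills.BalabanUVNodes.N15.TwoGrid (TGIndex tgGeoC tdistT_eq_tdist_torIdx)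
open Summit.QuantumFields.YangMills.BalabanUVNodes.N15.GenuineSite (genuineSiteStep genuineSiteStep_ker etaRateIneqSite_opGeo_unit)
open Summit.QuantumFields.YangMills.BalabanUVNodes.N15.GenuineRecord (tgSiteOn tgSiteOn_ker)
open Summit.QuantumFields.YangMills.BalabanUVNodes.N15.UnitLayerBg (tgCovExOn ne2PlusUnit_tgCovExOn_of_letters)
open YMDAG.UVSplit (N15At)

variable {d : ℕ} {L : ℕ} [NeZero L]

omit [NeZero L] in
/-- THE PERTURBED GENUINE SITE KERNEL `(Q′G′²Q′*_{n,a} + P)⁻¹` on the coarse index of a unit torus — the dressed site kernel of [B9] (3.65)–(3.67) with the `U ≡ 1` site form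
[B5]'s genuine `Q′G′²Q′*` (b04∕b05 `qggqRe`) and the dressing words collected in ONE perturbation matrix `P`. [cite: Balaban1985BackgroundPropagators, (3.65)–(3.67) p.403 (shape);
Balaban1984PropagatorsI, (1.45) p.26 (the `U ≡ 1` form)] -/
def siteEx (n : ℕ) [NeZero n] (a : ℝ) (M : Fin (d + 1) → ℕ) (P : Matrix (Idx M) (Idx M) ℝ) : Matrix (Idx M) (Idx M) ℝ :=
  (qggqRe n a M + P)⁻¹

omit [NeZero L] in
/-- At `P = 0` the perturbed kernel IS the genuine `U ≡ 1` site kernel `(Q′G′²Q′*)⁻¹ = kerRe` (b05 `qggqRe_inv`). [cite: Balaban1984PropagatorsI, p.25, (1.45) p.26] -/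
theorem siteEx_zero (n : ℕ) [NeZero n] (hn : 1 ≤ n) {a : ℝ} (ha : 0 < a) (M : Fin (d + 1) → ℕ) (hM : ∀ i, 1 ≤ M i) :
    siteEx n a M 0 = kerRe n a M := by
  unfold siteEx
  rw [add_zero, qggqRe_inv n hn a ha hM]

variable {I : Type} (ι : I → TGIndex) (gf : I → B9.Geometry) (Bc Bf : I → B9.Backgrounds)

/-- ★ **THE SITE SOCKET KERNEL** on the family `pi i = ⟨tgGeoC (ι i), gf i, Bc i, Bf i, pair i⟩` with fine-run site perturbations `Pf i : (Bf i).Cfg → sites × sites` and coarse-run ones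
`Pc i : (Bc i).Cfg → sites × sites` (sites = the coarse index `Idx M` of the unit torus of record `M_μ = 2L^{m_T}`, common to both runs — King's identity pairing):
`(U, y, y′) ↦ (Q′G′²Q′*_{L^m·L^k, a_{k+m}} + Pf i U)⁻¹(y,y′) − (Q′G′²Q′*_{L^k, a_k} + Pc i (avg U))⁻¹(y,y′)` — the η-difference of the DRESSED site kernels of the two runs, the background
entering through the perturbations. [cite: Balaban1985BackgroundPropagators, Thm 3.2 (3.48) p.398 + (3.65)–(3.67) p.403 (shape of the dressed site kernel); King1986, p.664 (identity pairing)] -/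
def tgSiteExOn (d : ℕ) (hL : Odd L ∧ 1 < L) (aS : ℝ) (pair : ∀ i, EtaPairing (tgGeoC d hL (ι i)) (gf i) (Bc i) (Bf i))
    (Pf : ∀ i, (Bf i).Cfg → Matrix (Idx (TGIndex.Mn d hL (ι i))) (Idx (TGIndex.Mn d hL (ι i))) ℝ)
    (Pc : ∀ i, (Bc i).Cfg → Matrix (Idx (TGIndex.Mn d hL (ι i))) (Idx (TGIndex.Mn d hL (ι i))) ℝ) (i : I) :
    B9.SiteKernel (tgGeoC d hL (ι i)) (Bf i) :=
  ⟨fun U y y' =>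
    siteEx (L ^ (ι i).m * L ^ (ι i).k) (aK aS L ((ι i).k + (ι i).m)) (TGIndex.Mn d hL (ι i)) (Pf i U)
        (torIdx (TGIndex.Mn d hL (ι i)) y) (torIdx (TGIndex.Mn d hL (ι i)) y')
      - siteEx (L ^ (ι i).k) (aK aS L (ι i).k) (TGIndex.Mn d hL (ι i)) (Pc i ((pair i).avg U))
        (torIdx (TGIndex.Mn d hL (ι i)) y) (torIdx (TGIndex.Mn d hL (ι i)) y')⟩

/-- Unfolding of `tgSiteExOn`. [folklore] -/
theorem tgSiteExOn_ker (hL : Odd L ∧ 1 < L) (aS : ℝ) (pair : ∀ i, EtaPairing (tgGeoC d hL (ι i)) (gf i) (Bc i) (Bf i))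
    (Pf : ∀ i, (Bf i).Cfg → Matrix (Idx (TGIndex.Mn d hL (ι i))) (Idx (TGIndex.Mn d hL (ι i))) ℝ)
    (Pc : ∀ i, (Bc i).Cfg → Matrix (Idx (TGIndex.Mn d hL (ι i))) (Idx (TGIndex.Mn d hL (ι i))) ℝ) (i : I) (U : (Bf i).Cfg)
    (y y' : Tor (TGIndex.Mn d hL (ι i))) :
    (tgSiteExOn ι gf Bc Bf d hL aS pair Pf Pc i).ker U y y' =
      siteEx (L ^ (ι i).m * L ^ (ι i).k) (aK aS L ((ι i).k + (ι i).m)) (TGIndex.Mn d hL (ι i)) (Pf i U)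
          (torIdx (TGIndex.Mn d hL (ι i)) y) (torIdx (TGIndex.Mn d hL (ι i)) y')
        - siteEx (L ^ (ι i).k) (aK aS L (ι i).k) (TGIndex.Mn d hL (ι i)) (Pc i ((pair i).avg U))
          (torIdx (TGIndex.Mn d hL (ι i)) y) (torIdx (TGIndex.Mn d hL (ι i)) y') := rfl

/-- ★ **WHERE BOTH PERTURBATIONS VANISH THE SOCKET KERNEL IS PART 78's `tgSiteOn`** (dag-n15-c G1's genuine `U ≡ 1` site kernel `(Q′G′²Q′*)⁻¹′ − (Q′G′²Q′*)⁻¹` re-based): the socket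
DEFORMS the U-blind site layer of dag-n15-a's `n15At_tgEx_of_ne2PlusOperator`, it does not re-label it. [cite: Balaban1984PropagatorsI, p.25, (1.45) p.26] -/
theorem tgSiteExOn_of_zero (hL : Odd L ∧ 1 < L) {aS : ℝ} (haS : 0 < aS) (pair : ∀ i, EtaPairing (tgGeoC d hL (ι i)) (gf i) (Bc i) (Bf i))
    (Pf : ∀ i, (Bf i).Cfg → Matrix (Idx (TGIndex.Mn d hL (ι i))) (Idx (TGIndex.Mn d hL (ι i))) ℝ)
    (Pc : ∀ i, (Bc i).Cfg → Matrix (Idx (TGIndex.Mn d hL (ι i))) (Idx (TGIndex.Mn d hL (ι i))) ℝ) (i : I) (U : (Bf i).Cfg)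
    (hf : Pf i U = 0) (hc : Pc i ((pair i).avg U) = 0) (y y' : Tor (TGIndex.Mn d hL (ι i))) :
    (tgSiteExOn ι gf Bc Bf d hL aS pair Pf Pc i).ker U y y' = (tgSiteOn d hL aS ι Bf i).ker U y y' := by
  have hL0 : 0 < L := by have := hL.2; omega
  have hLr : (1 : ℝ) < L := by exact_mod_cast hL.2
  have hk := (ι i).one_le
  have hLk : 1 ≤ L ^ (ι i).k := Nat.one_le_pow _ _ hL0
  have hLmk : 1 ≤ L ^ (ι i).m * L ^ (ι i).k :=
    Nat.one_le_iff_ne_zero.mpr (Nat.mul_ne_zero (by have := Nat.one_le_pow (ι i).m L hL0; omega) (by omega))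
  have hM1 : ∀ μ, 1 ≤ TGIndex.Mn d hL (ι i) μ := fun μ => Nat.one_le_iff_ne_zero.mpr (NeZero.ne _)
  rw [tgSiteExOn_ker, hf, hc, siteEx_zero _ hLmk (aK_pos haS hLr (by omega)) _ hM1, siteEx_zero _ hLk (aK_pos haS hLr hk) _ hM1, tgSiteOn_ker,
    genuineSiteStep_ker]

/-- ★★★ **THE SITE SOCKET — `NE2PlusSite` BY NAME FROM THE PERTURBATIONS' LETTERS ALONE.**  Let `L ≥ 3` be odd, `a_S > 0` (King's coupling seed), `c₃₅`, exponents `(d′, p)`; a family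
`pi i = ⟨tgGeoC (ι i), gf i, Bc i, Bf i, pair i⟩` with guard scales `(gf i).M ≥ 1`; a rate exponent `γ_P > 0`; and site-perturbation maps `Pf`, `Pc` with THE THREE LETTERS: there are
`δ_P, ζ, τ, a₁ > 0` such that for every `i`, every `0 < α₀ ≤ a₁` and every `U` regular at level `c₃₅` (`Reg335 c₃₅ α₀ U`), `|Pc i (avg U)|, |Pf i U| ≤ ζα₀·e^{−δ_P·tdist}` and
`|Pf i U − Pc i (avg U)| ≤ τ·(L^k)^{−γ_P}·e^{−δ_P·tdist}` (entrywise on the coarse index).  THEN `NE2PlusSite d′ p c₃₅ pi (tgSiteExOn …)` with constants `(M₅, δ, a₀, C, γ) =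
(1, κ₁∕2, min a₁ (γ₀∕(4ζV₁)), (4∕γ₀)²(C_r + τ)V₂², min ¼ γ_P)` — `γ₀, C_r` the genuine form's coercivity and two-grid letters (§2), `κ₁` the Combes–Thomas rate, `V₁, V₂` King's torus sums:
a smallness in `α₀` ALONE, NO weight window, NO Neumann series.  Chain: §2 `siteForm_letters_family` + `hP` → §1 `abs_inv_add_sub_inv_add_le_of_coercive` → G1's unit-site readout
`etaRateIneqSite_opGeo_unit`. [cite: Balaban1985BackgroundPropagators, Thm 3.2 (3.48) p.398 + Thm 3.14 pp.426–427 (quantifier template), (3.65)–(3.67) p.403 (mechanism: a small decaying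
perturbation of the site form, inverse by perturbation); Balaban1984PropagatorsI, (1.45) p.26; King1986, Prop. 3.8 (3.71) p.664, (4.40)–(4.41) pp.674–675 (rate shape and mechanism);
CombesThomas1973, §II] -/
theorem ne2PlusSite_tgSiteExOn_of_letters (hLodd : Odd L) (hL2 : 2 ≤ L) (hL : Odd L ∧ 1 < L) {aS : ℝ} (haS : 0 < aS) (c35 : ℝ) (d' : ℕ) (p : ℝ)
    (hM : ∀ i, 1 ≤ (gf i).M) (pair : ∀ i, EtaPairing (tgGeoC d hL (ι i)) (gf i) (Bc i) (Bf i))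
    (Pf : ∀ i, (Bf i).Cfg → Matrix (Idx (TGIndex.Mn d hL (ι i))) (Idx (TGIndex.Mn d hL (ι i))) ℝ)
    (Pc : ∀ i, (Bc i).Cfg → Matrix (Idx (TGIndex.Mn d hL (ι i))) (Idx (TGIndex.Mn d hL (ι i))) ℝ) {γP : ℝ} (hγP : 0 < γP)
    (hP : ∃ δP ζ τ a₁ : ℝ, 0 < δP ∧ 0 < ζ ∧ 0 < τ ∧ 0 < a₁ ∧
      ∀ (i : I) (α₀ : ℝ), 0 < α₀ → α₀ ≤ a₁ → ∀ U : (Bf i).Cfg, (Bf i).Reg335 c35 α₀ U →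
        (∀ p q : Idx (TGIndex.Mn d hL (ι i)), |Pc i ((pair i).avg U) p q| ≤ ζ * α₀ * Real.exp (-(δP * tdist (TGIndex.Mn d hL (ι i)) p q))) ∧
        (∀ p q : Idx (TGIndex.Mn d hL (ι i)), |Pf i U p q| ≤ ζ * α₀ * Real.exp (-(δP * tdist (TGIndex.Mn d hL (ι i)) p q))) ∧
        (∀ p q : Idx (TGIndex.Mn d hL (ι i)), |Pf i U p q - Pc i ((pair i).avg U) p q|
            ≤ τ * ((L : ℝ) ^ (ι i).k) ^ (-γP) * Real.exp (-(δP * tdist (TGIndex.Mn d hL (ι i)) p q)))) :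
    NE2PlusSite d' p c35 (fun i => (⟨tgGeoC d hL (ι i), gf i, Bc i, Bf i, pair i⟩ : PairedInstance)) (tgSiteExOn ι gf Bc Bf d hL aS pair Pf Pc) := by
  obtain ⟨γ₀, c₀, δ, Cr, hγ₀, hc₀, hδ, hCr, HF⟩ := siteForm_letters_family (d := d) hLodd hL2 haS
  obtain ⟨δP, ζ, τ, a₁, hδP, hζ, hτ, ha₁, HP⟩ := hP
  have hL0 : 0 < L := by omega
  have hLr : (1 : ℝ) < L := by exact_mod_cast (show 1 < L by omega)
  have hLR : (1 : ℝ) ≤ L := hLr.le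
  -- the common rate, King's torus sums, the Combes–Thomas rate, the threshold
  obtain ⟨κ, hκdef⟩ : ∃ κ : ℝ, κ = min δ δP := ⟨_, rfl⟩
  have hκ : 0 < κ := hκdef ▸ lt_min hδ hδP
  have hκδ : κ ≤ δ := hκdef ▸ min_le_left _ _
  have hκP : κ ≤ δP := hκdef ▸ min_le_right _ _
  obtain ⟨V₁, hV₁def⟩ : ∃ V₁ : ℝ, V₁ = latticeConst (d + 1) (κ / 4) + 1 := ⟨_, rfl⟩
  have hV₁1 : 1 ≤ V₁ := by rw [hV₁def]; linarith [latticeConst_nonneg (d + 1) (show 0 ≤ κ / 4 by positivity)]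
  have hV₁0 : 0 < V₁ := by linarith
  obtain ⟨κ₁, hκ₁def⟩ : ∃ κ₁ : ℝ, κ₁ = min (κ / 4) (γ₀ * κ / (8 * (c₀ + ζ * a₁) * V₁)) := ⟨_, rfl⟩
  have hden : 0 < 8 * (c₀ + ζ * a₁) * V₁ := by positivity
  have hκ₁ : 0 < κ₁ := hκ₁def ▸ lt_min (by positivity) (div_pos (by positivity) hden)
  have hκ₁κ : κ₁ ≤ κ / 4 := hκ₁def ▸ min_le_left _ _
  have hκ₁s : 8 * (c₀ + ζ * a₁) * V₁ * κ₁ ≤ γ₀ * κ := by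
    have h1 : κ₁ ≤ γ₀ * κ / (8 * (c₀ + ζ * a₁) * V₁) := hκ₁def ▸ min_le_right _ _
    have h2 := mul_le_mul_of_nonneg_left h1 hden.le
    rwa [mul_div_cancel₀ _ hden.ne'] at h2
  obtain ⟨V₂, hV₂def⟩ : ∃ V₂ : ℝ, V₂ = latticeConst (d + 1) (κ₁ / 2) + 1 := ⟨_, rfl⟩
  have hV₂0 : 0 < V₂ := by rw [hV₂def]; linarith [latticeConst_nonneg (d + 1) (show 0 ≤ κ₁ / 2 by positivity)]
  obtain ⟨a₀, ha₀def⟩ : ∃ a₀ : ℝ, a₀ = min a₁ (γ₀ / (4 * ζ * V₁)) := ⟨_, rfl⟩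
  have ha₀ : 0 < a₀ := ha₀def ▸ lt_min ha₁ (div_pos hγ₀ (by positivity))
  obtain ⟨γo, hγodef⟩ : ∃ γo : ℝ, γo = min (1 / 4) γP := ⟨_, rfl⟩
  have hγo : 0 < γo := hγodef ▸ lt_min (by norm_num) hγP
  have hγo4 : γo ≤ 1 / 4 := hγodef ▸ min_le_left _ _
  have hγoP : γo ≤ γP := hγodef ▸ min_le_right _ _
  refine ⟨1, κ₁ / 2, a₀, 4 / γ₀ * (Cr + τ) * (4 / γ₀) * V₂ ^ 2, γo, one_pos, half_pos hκ₁, ha₀, by positivity, hγo, fun i _ α₀ hα₀ hMα U hreg => ?_⟩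
  -- this index: its torus, its letters
  have hαa₀ : α₀ ≤ a₀ := (le_mul_of_one_le_left hα₀.le (hM i)).trans hMα
  have hαa₁ : α₀ ≤ a₁ := hαa₀.trans (ha₀def ▸ min_le_left _ _)
  have hM1 : ∀ μ, 1 ≤ TGIndex.Mn d hL (ι i) μ := fun μ => Nat.one_le_iff_ne_zero.mpr (NeZero.ne _)
  obtain ⟨hcoK, hcoK', hK, hK', hKK⟩ := HF (ι i).mT (ι i).k (ι i).m (ι i).one_le (TGIndex.Mn d hL (ι i)) (fun μ => rfl)
  obtain ⟨hPc, hPf, hPfc⟩ := HP i α₀ hα₀ hαa₁ U hreg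
  -- the distance letters of King's `tdist`
  have hρ : ∀ p q : Idx (TGIndex.Mn d hL (ι i)), 0 ≤ tdist (TGIndex.Mn d hL (ι i)) p q := tdist_nonneg _
  have hρs : ∀ p q : Idx (TGIndex.Mn d hL (ι i)), tdist (TGIndex.Mn d hL (ι i)) p q = tdist (TGIndex.Mn d hL (ι i)) q p := tdist_symm hM1
  have hρ0 : ∀ p : Idx (TGIndex.Mn d hL (ι i)), tdist (TGIndex.Mn d hL (ι i)) p p = 0 := tdist_self _
  have hρt : ∀ p q r : Idx (TGIndex.Mn d hL (ι i)), tdist (TGIndex.Mn d hL (ι i)) p r ≤ tdist (TGIndex.Mn d hL (ι i)) p q + tdist (TGIndex.Mn d hL (ι i)) q r :=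
    tdist_triangle hM1
  have hV₁ : ∀ p : Idx (TGIndex.Mn d hL (ι i)), ∑ q, Real.exp (-(κ / 4 * tdist (TGIndex.Mn d hL (ι i)) p q)) ≤ V₁ := fun p =>
    (torusSum_le (d + 1) hM1 (by positivity) p).trans (by rw [hV₁def]; linarith)
  have hV₂ : ∀ p : Idx (TGIndex.Mn d hL (ι i)), ∑ q, Real.exp (-(κ₁ / 2 * tdist (TGIndex.Mn d hL (ι i)) p q)) ≤ V₂ := fun p =>
    (torusSum_le (d + 1) hM1 (by positivity) p).trans (by rw [hV₂def]; linarith)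
  -- the rate factors: `(L^k)^{−¼}, (L^k)^{−γ_P} ≤ (L^k)^{−γo}`
  have hLk1 : (1 : ℝ) ≤ (L : ℝ) ^ (ι i).k := one_le_pow₀ hLR
  have hr4 : ((L : ℝ) ^ (ι i).k) ^ (-(1 / 4 : ℝ)) ≤ ((L : ℝ) ^ (ι i).k) ^ (-γo) := Real.rpow_le_rpow_of_exponent_le hLk1 (by linarith)
  have hrP : ((L : ℝ) ^ (ι i).k) ^ (-γP) ≤ ((L : ℝ) ^ (ι i).k) ^ (-γo) := Real.rpow_le_rpow_of_exponent_le hLk1 (by linarith)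
  have hro : 0 ≤ ((L : ℝ) ^ (ι i).k) ^ (-γo) := Real.rpow_nonneg (by positivity) _
  -- all letters at the common rate κ
  have hK₁ : ∀ p q, |qggqRe (L ^ (ι i).k) (aK aS L (ι i).k) (TGIndex.Mn d hL (ι i)) p q| ≤ c₀ * Real.exp (-(κ * tdist (TGIndex.Mn d hL (ι i)) p q)) :=
    fun p q => (hK p q).trans (exp_decay_mono hc₀.le hκδ (hρ p q))
  have hK₁' : ∀ p q, |qggqRe (L ^ (ι i).m * L ^ (ι i).k) (aK aS L ((ι i).k + (ι i).m)) (TGIndex.Mn d hL (ι i)) p q| ≤ c₀ * Real.exp (-(κ * tdist (TGIndex.Mn d hL (ι i)) p q)) :=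
    fun p q => (hK' p q).trans (exp_decay_mono hc₀.le hκδ (hρ p q))
  have hKK₁ : ∀ p q, |qggqRe (L ^ (ι i).m * L ^ (ι i).k) (aK aS L ((ι i).k + (ι i).m)) (TGIndex.Mn d hL (ι i)) p q - qggqRe (L ^ (ι i).k) (aK aS L (ι i).k) (TGIndex.Mn d hL (ι i)) p q|
      ≤ Cr * ((L : ℝ) ^ (ι i).k) ^ (-γo) * Real.exp (-(κ * tdist (TGIndex.Mn d hL (ι i)) p q)) := fun p q =>
    (hKK p q).trans ((mul_le_mul_of_nonneg_right (mul_le_mul_of_nonneg_left hr4 hCr.le) (Real.exp_nonneg _)).trans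
      (exp_decay_mono (mul_nonneg hCr.le hro) hκδ (hρ p q)))
  have hPc₁ : ∀ p q, |Pc i ((pair i).avg U) p q| ≤ ζ * α₀ * Real.exp (-(κ * tdist (TGIndex.Mn d hL (ι i)) p q)) :=
    fun p q => (hPc p q).trans (exp_decay_mono (by positivity) hκP (hρ p q))
  have hPf₁ : ∀ p q, |Pf i U p q| ≤ ζ * α₀ * Real.exp (-(κ * tdist (TGIndex.Mn d hL (ι i)) p q)) :=
    fun p q => (hPf p q).trans (exp_decay_mono (by positivity) hκP (hρ p q))
  have hPP₁ : ∀ p q, |Pf i U p q - Pc i ((pair i).avg U) p q| ≤ τ * ((L : ℝ) ^ (ι i).k) ^ (-γo) * Real.exp (-(κ * tdist (TGIndex.Mn d hL (ι i)) p q)) := fun p q =>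
    (hPfc p q).trans ((mul_le_mul_of_nonneg_right (mul_le_mul_of_nonneg_left hrP hτ.le) (Real.exp_nonneg _)).trans
      (exp_decay_mono (mul_nonneg hτ.le hro) hκP (hρ p q)))
  -- the two smallness conditions at this `α₀`
  have hs₁ : ζ * α₀ * V₁ ≤ γ₀ / 2 := by
    have h1 : α₀ ≤ γ₀ / (4 * ζ * V₁) := hαa₀.trans (ha₀def ▸ min_le_right _ _)
    have h2 := mul_le_mul_of_nonneg_left h1 (show 0 ≤ 4 * ζ * V₁ by positivity)
    rw [mul_div_cancel₀ _ (by positivity : (4 * ζ * V₁ : ℝ) ≠ 0)] at h2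
    nlinarith
  have hs₂ : 8 * (c₀ + ζ * α₀) * V₁ * κ₁ ≤ γ₀ * κ := by
    have h1 : 8 * (c₀ + ζ * α₀) * V₁ * κ₁ ≤ 8 * (c₀ + ζ * a₁) * V₁ * κ₁ := by
      have := mul_le_mul_of_nonneg_left hαa₁ hζ.le
      have hVκ : 0 ≤ V₁ * κ₁ := by positivity
      nlinarith
    exact h1.trans hκ₁s
  -- §1's two-form rate at this index
  have h := abs_inv_add_sub_inv_add_le_of_coercive (tdist (TGIndex.Mn d hL (ι i))) hρ hρs hρ0 hρt hγ₀ hc₀.le (by positivity : 0 ≤ ζ * α₀)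
    (by positivity : 0 ≤ Cr * ((L : ℝ) ^ (ι i).k) ^ (-γo)) (by positivity : 0 ≤ τ * ((L : ℝ) ^ (ι i).k) ^ (-γo)) hκ hκ₁.le hκ₁κ hcoK hcoK' hK₁ hK₁' hPc₁ hPf₁ hKK₁ hPP₁
    hV₁ hV₂ hs₁ hs₂
  -- the unit-site readout (G1): prefactors `1`, rate factor `(L^k)^{−γo}`
  have hLne : L ≠ 0 := NeZero.ne L
  have hLpos : (0 : ℝ) < (L : ℝ) := by exact_mod_cast hL0
  have hη : (unitTorusGeo L (ι i).k (TGIndex.Mn d hL (ι i))).eta ≠ 0 := inv_ne_zero (pow_ne_zero _ hLpos.ne')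
  refine etaRateIneqSite_opGeo_unit (g := unitTorusGeo L (ι i).k (TGIndex.Mn d hL (ι i))) (B := Bf i) (tgSiteExOn ι gf Bc Bf d hL aS pair Pf Pc i)
    (unitTorusGeo_len L (ι i).k (TGIndex.Mn d hL (ι i)) hLne) hη hLpos (fun y y' => ?_) d' p
  have hyy := h (torIdx (TGIndex.Mn d hL (ι i)) y) (torIdx (TGIndex.Mn d hL (ι i)) y')
  rw [← tdistT_eq_tdist_torIdx] at hyy
  show |siteEx (L ^ (ι i).m * L ^ (ι i).k) (aK aS L ((ι i).k + (ι i).m)) (TGIndex.Mn d hL (ι i)) (Pf i U)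
          (torIdx (TGIndex.Mn d hL (ι i)) y) (torIdx (TGIndex.Mn d hL (ι i)) y')
        - siteEx (L ^ (ι i).k) (aK aS L (ι i).k) (TGIndex.Mn d hL (ι i)) (Pc i ((pair i).avg U))
          (torIdx (TGIndex.Mn d hL (ι i)) y) (torIdx (TGIndex.Mn d hL (ι i)) y')|
      ≤ 4 / γ₀ * (Cr + τ) * (4 / γ₀) * V₂ ^ 2 * Real.exp (-(κ₁ / 2 * tdistT (TGIndex.Mn d hL (ι i)) y y')) *
        max (((L : ℝ) ^ (ι i).k) ^ (-γo)) (((L : ℝ) ^ (ι i).k) ^ (-γo))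
  rw [max_self]
  unfold siteEx
  refine hyy.trans (le_of_eq ?_)
  ring

/-- **A6 — THE LETTERS ARE SATISFIABLE (and by what)**: the ZERO site perturbations carry the three letters (`δ_P = ζ = τ = a₁ = 1`, any `γ_P`); there the socket kernel IS
part 78's U-blind `tgSiteOn` (`tgSiteExOn_of_zero`) — the trivial inhabitant; a U-SEEING inhabitant is a site-perturbation species of (3.65)-shape with its letters from (3.35)
(successor file). [bookkeeping] -/
theorem siteLetters_zero (hL : Odd L ∧ 1 < L) (c35 : ℝ) (pair : ∀ i, EtaPairing (tgGeoC d hL (ι i)) (gf i) (Bc i) (Bf i)) (γP : ℝ) :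
    ∃ δP ζ τ a₁ : ℝ, 0 < δP ∧ 0 < ζ ∧ 0 < τ ∧ 0 < a₁ ∧
      ∀ (i : I) (α₀ : ℝ), 0 < α₀ → α₀ ≤ a₁ → ∀ U : (Bf i).Cfg, (Bf i).Reg335 c35 α₀ U →
        (∀ p q : Idx (TGIndex.Mn d hL (ι i)),
            |(fun (i : I) (_ : (Bc i).Cfg) => (0 : Matrix (Idx (TGIndex.Mn d hL (ι i))) (Idx (TGIndex.Mn d hL (ι i))) ℝ)) i ((pair i).avg U) p q|
              ≤ ζ * α₀ * Real.exp (-(δP * tdist (TGIndex.Mn d hL (ι i)) p q))) ∧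
        (∀ p q : Idx (TGIndex.Mn d hL (ι i)),
            |(fun (i : I) (_ : (Bf i).Cfg) => (0 : Matrix (Idx (TGIndex.Mn d hL (ι i))) (Idx (TGIndex.Mn d hL (ι i))) ℝ)) i U p q|
              ≤ ζ * α₀ * Real.exp (-(δP * tdist (TGIndex.Mn d hL (ι i)) p q))) ∧
        (∀ p q : Idx (TGIndex.Mn d hL (ι i)),
            |(fun (i : I) (_ : (Bf i).Cfg) => (0 : Matrix (Idx (TGIndex.Mn d hL (ι i))) (Idx (TGIndex.Mn d hL (ι i))) ℝ)) i U p q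
              - (fun (i : I) (_ : (Bc i).Cfg) => (0 : Matrix (Idx (TGIndex.Mn d hL (ι i))) (Idx (TGIndex.Mn d hL (ι i))) ℝ)) i ((pair i).avg U) p q|
              ≤ τ * ((L : ℝ) ^ (ι i).k) ^ (-γP) * Real.exp (-(δP * tdist (TGIndex.Mn d hL (ι i)) p q))) := by
  have hL0 : (0 : ℝ) < (L : ℝ) := by exact_mod_cast (show 0 < L by have := hL.2; omega)
  refine ⟨1, 1, 1, 1, one_pos, one_pos, one_pos, one_pos, fun i α₀ hα₀ _ U _ => ⟨fun p q => ?_, fun p q => ?_, fun p q => ?_⟩⟩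
  · simp only [Matrix.zero_apply, abs_zero]; positivity
  · simp only [Matrix.zero_apply, abs_zero]; positivity
  · simp only [Matrix.zero_apply, sub_zero, abs_zero]
    exact mul_nonneg (mul_nonneg zero_le_one (Real.rpow_nonneg (pow_nonneg hL0.le _) _)) (Real.exp_nonneg _)

/-- **THE TRIVIAL INHABITANT THROUGH THE SOCKET**: at the zero perturbations `NE2PlusSite` holds by `ne2PlusSite_tgSiteExOn_of_letters` (there the kernel is part 78's, by
`tgSiteExOn_of_zero`; G1's `ne2PlusSite_genuineSite` is the direct proof) — the socket agrees with the layer it deforms. [bookkeeping] -/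
theorem ne2PlusSite_tgSiteExOn_zero (hLodd : Odd L) (hL2 : 2 ≤ L) (hL : Odd L ∧ 1 < L) {aS : ℝ} (haS : 0 < aS) (c35 : ℝ) (d' : ℕ) (p : ℝ)
    (hM : ∀ i, 1 ≤ (gf i).M) (pair : ∀ i, EtaPairing (tgGeoC d hL (ι i)) (gf i) (Bc i) (Bf i)) :
    NE2PlusSite d' p c35 (fun i => (⟨tgGeoC d hL (ι i), gf i, Bc i, Bf i, pair i⟩ : PairedInstance))
      (tgSiteExOn ι gf Bc Bf d hL aS pair (fun _ _ => 0) (fun _ _ => 0)) :=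
  ne2PlusSite_tgSiteExOn_of_letters ι gf Bc Bf hLodd hL2 hL haS c35 d' p hM pair (fun _ _ => 0) (fun _ _ => 0) one_pos (siteLetters_zero ι gf Bc Bf hL c35 pair 1)

end Socket

/-! ## §4 ★★★ The knit: an operator layer BY NAME + the unit letters (V-F) + the site letters ⟹ `N15At` with EVERY layer reading the configuration -/

section Knit

open Literature.MathematicalPhysics.QuantumFieldTheory.Balaban1983to89.T4EtaRate (PairedInstance EtaPairing NE2PlusOperator NE2PlusSite NE2PlusUnit)
open Literature.MathematicalPhysics.QuantumFieldTheory.Balaban1983to89.B4Sect5Torus (tdist)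
open Literature.MathematicalPhysics.QuantumFieldTheory.Balaban1983to89.B5QGGQ145Bounds (Idx)
open Literature.MathematicalPhysics.QuantumFieldTheory.Balaban1983to89.B6Lemma24Torus (pbox)
open Literature.MathematicalPhysics.QuantumFieldTheory.Balaban1983to89.B6BondEliminationTorus (pdist)
open Literature.MathematicalPhysics.QuantumFieldTheory.Balaban1983to89.B6Cov2156Torus (one_le_M)
open Summit.QuantumFields.YangMills.BalabanUVNodes.N15.TwoGrid (TGIndex tgGeoC)
open Summit.QuantumFields.YangMills.BalabanUVNodes.N15.UnitLayerBg (tgCovExOn ne2PlusUnit_tgCovExOn_of_letters)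
open YMDAG.UVSplit (N15At)
variable {d : ℕ} {L : ℕ} [NeZero L] {I : Type} (ι : I → TGIndex) (gf : I → B9.Geometry) (Bc Bf : I → B9.Backgrounds)
/-- ★★★ **`N15At` ON ANY SUCH FAMILY FROM AN OPERATOR LAYER BY NAME, THE MIDDLE FACTORS' LETTERS AND THE SITE PERTURBATIONS' LETTERS** — dag-n15-a V-F's
`n15At_tgEx_of_ne2PlusOperator` with the U-BLIND site layer `tgSiteOn` REPLACED by §3's socket: OPERATOR = the hypothesis `hop`; SITE = `ne2PlusSite_tgSiteExOn_of_letters` (letters `hP`);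
UNIT = V-F `ne2PlusUnit_tgCovExOn_of_letters` (letters `hZ`).  Every layer of the node's conjunction now READS THE CONFIGURATION (through the operator family, the site perturbations
`Pf∕Pc`, and the middle factors `Zf∕Zc` respectively). [bookkeeping] -/
theorem n15At_tgExEx_of_ne2PlusOperator (hd : 1 ≤ d) (hLodd : Odd L) (hL2 : 2 ≤ L) (hL : Odd L ∧ 1 < L) {b aS : ℝ} (hb : 0 < b) (haS : 0 < aS) (α β : Fin (d + 1))
    (hι : ∀ i, 1 ≤ (ι i).mT) (hM : ∀ i, 1 ≤ (gf i).M) (pair : ∀ i, EtaPairing (tgGeoC d hL (ι i)) (gf i) (Bc i) (Bf i)) {c35 : ℝ} (p : ℝ)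
    (Kop : ∀ i, B9.KernelFamily (tgGeoC d hL (ι i)) (Bf i))
    (hop : NE2PlusOperator c35 (fun i => (⟨tgGeoC d hL (ι i), gf i, Bc i, Bf i, pair i⟩ : PairedInstance)) Kop)
    (Zf : ∀ i, (Bf i).Cfg → Matrix (B4.Idx (pbox (TGIndex.Mn d hL (ι i))) (d + 1)) (B4.Idx (pbox (TGIndex.Mn d hL (ι i))) (d + 1)) ℝ)
    (Zc : ∀ i, (Bc i).Cfg → Matrix (B4.Idx (pbox (TGIndex.Mn d hL (ι i))) (d + 1)) (B4.Idx (pbox (TGIndex.Mn d hL (ι i))) (d + 1)) ℝ)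
    {θZ : ℝ} (hθL : (L : ℝ)⁻¹ ≤ θZ) (hθ1 : θZ < 1)
    (hZ : ∃ δZ ζ τ a₁ : ℝ, 0 < δZ ∧ 0 < ζ ∧ 0 < τ ∧ 0 < a₁ ∧
      ∀ (i : I) (α₀ : ℝ), 0 < α₀ → α₀ ≤ a₁ → ∀ U : (Bf i).Cfg, (Bf i).Reg335 c35 α₀ U →
        (∀ p q : B4.Idx (pbox (TGIndex.Mn d hL (ι i))) (d + 1),
            |Zc i ((pair i).avg U) p q| ≤ ζ * α₀ * Real.exp (-(δZ * pdist (TGIndex.Mn d hL (ι i)) (one_le_M _) (p.1 : Fin (d + 1) → ℤ) (q.1 : Fin (d + 1) → ℤ)))) ∧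
        (∀ p q : B4.Idx (pbox (TGIndex.Mn d hL (ι i))) (d + 1),
            |Zf i U p q| ≤ ζ * α₀ * Real.exp (-(δZ * pdist (TGIndex.Mn d hL (ι i)) (one_le_M _) (p.1 : Fin (d + 1) → ℤ) (q.1 : Fin (d + 1) → ℤ)))) ∧
        (∀ p q : B4.Idx (pbox (TGIndex.Mn d hL (ι i))) (d + 1),
            |Zf i U p q - Zc i ((pair i).avg U) p q| ≤ τ * θZ ^ (ι i).k * Real.exp (-(δZ * pdist (TGIndex.Mn d hL (ι i)) (one_le_M _) (p.1 : Fin (d + 1) → ℤ) (q.1 : Fin (d + 1) → ℤ)))))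
    (Pf : ∀ i, (Bf i).Cfg → Matrix (Idx (TGIndex.Mn d hL (ι i))) (Idx (TGIndex.Mn d hL (ι i))) ℝ)
    (Pc : ∀ i, (Bc i).Cfg → Matrix (Idx (TGIndex.Mn d hL (ι i))) (Idx (TGIndex.Mn d hL (ι i))) ℝ) {γP : ℝ} (hγP : 0 < γP)
    (hP : ∃ δP ζ τ a₁ : ℝ, 0 < δP ∧ 0 < ζ ∧ 0 < τ ∧ 0 < a₁ ∧
      ∀ (i : I) (α₀ : ℝ), 0 < α₀ → α₀ ≤ a₁ → ∀ U : (Bf i).Cfg, (Bf i).Reg335 c35 α₀ U →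
        (∀ p q : Idx (TGIndex.Mn d hL (ι i)), |Pc i ((pair i).avg U) p q| ≤ ζ * α₀ * Real.exp (-(δP * tdist (TGIndex.Mn d hL (ι i)) p q))) ∧
        (∀ p q : Idx (TGIndex.Mn d hL (ι i)), |Pf i U p q| ≤ ζ * α₀ * Real.exp (-(δP * tdist (TGIndex.Mn d hL (ι i)) p q))) ∧
        (∀ p q : Idx (TGIndex.Mn d hL (ι i)), |Pf i U p q - Pc i ((pair i).avg U) p q|
            ≤ τ * ((L : ℝ) ^ (ι i).k) ^ (-γP) * Real.exp (-(δP * tdist (TGIndex.Mn d hL (ι i)) p q)))) :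
    N15At { I := I, c35 := c35, p := p, pi := fun i => ⟨tgGeoC d hL (ι i), gf i, Bc i, Bf i, pair i⟩, Kop := Kop,
            Ksite := tgSiteExOn ι gf Bc Bf d hL aS pair Pf Pc, Kunit := tgCovExOn ι gf Bc Bf d hL b α β pair Zf Zc, inΛ := fun _ _ => True,
            unitDist := fun i => (tgGeoC d hL (ι i)).dist } :=
  ⟨hop, ne2PlusSite_tgSiteExOn_of_letters (d := d) ι gf Bc Bf hLodd hL2 hL haS c35 4 p hM pair Pf Pc hγP hP,
   ne2PlusUnit_tgCovExOn_of_letters (d := d) ι gf Bc Bf hd hL2 hL hb c35 α β hι hM pair Zf Zc hθL hθ1 hZ⟩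

end Knit

/-! ## §5 The knit at ANY KEYED HOME (dag-n15-a part 30's interface; part 78 §3's pattern) -/

section Home

open Literature.MathematicalPhysics.QuantumFieldTheory.Balaban1983to89.T4Continuum (T4Family ULoop)
open Literature.MathematicalPhysics.QuantumFieldTheory.Balaban1983to89.T4EtaRate (PairedInstance EtaPairing NE2PlusOperator)
open Literature.MathematicalPhysics.QuantumFieldTheory.Balaban1983to89.B4Sect5Torus (tdist)
open Literature.MathematicalPhysics.QuantumFieldTheory.Balaban1983to89.B5QGGQ145Bounds (Idx)
open Literature.MathematicalPhysics.QuantumFieldTheory.Balaban1983to89.B6Lemma24Torus (pbox)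
open Literature.MathematicalPhysics.QuantumFieldTheory.Balaban1983to89.B6BondEliminationTorus (pdist)
open Literature.MathematicalPhysics.QuantumFieldTheory.Balaban1983to89.B6Cov2156Torus (one_le_M)
open Node00 (NE2Objects₁₁)
open Summit.QuantumFields.YangMills.BalabanUVNodes.N15.TwoGrid (TGIndex tgGeoC)
open Summit.QuantumFields.YangMills.BalabanUVNodes.N15.UnitLayerBg (tgCovExOn)
open Summit.QuantumFields.YangMills.BalabanUVNodes.N15.AtKeyedHome (s_N15_of_admits)
open YMDAG.UVSplit (Datum RateCarriers RateRecordPred S_N15 ne2OfRecord₁₁)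

variable {d : ℕ} {L : ℕ} [NeZero L] {I : Type} (ι : I → TGIndex) (gf : I → B9.Geometry) (Bc Bf : I → B9.Backgrounds)
variable {N : ℕ} [NeZero N] {key : (F : T4Family) → Datum F N → Prop}

/-- ★★ **THE ALL-LAYERS-U-SEEING KNIT AT ANY KEYED HOME** (part 30's interface, part 78 §3's pattern): with the data of `n15At_tgExEx_of_ne2PlusOperator`, a rate home `RRec` over ANY
key admitting only the literals of a key-indexed NE2 reading whose value everywhere is the knitted bundle has `S_N15 RRec`. [bookkeeping] -/
theorem s_N15_of_admits_tgExEx_of_ne2PlusOperator (hd : 1 ≤ d) (hLodd : Odd L) (hL2 : 2 ≤ L) (hL : Odd L ∧ 1 < L) {b aS : ℝ} (hb : 0 < b) (haS : 0 < aS)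
    (α β : Fin (d + 1)) (hι : ∀ i, 1 ≤ (ι i).mT) (hM : ∀ i, 1 ≤ (gf i).M) (pair : ∀ i, EtaPairing (tgGeoC d hL (ι i)) (gf i) (Bc i) (Bf i)) {c35 : ℝ} (p : ℝ)
    (Kop : ∀ i, B9.KernelFamily (tgGeoC d hL (ι i)) (Bf i))
    (hop : NE2PlusOperator c35 (fun i => (⟨tgGeoC d hL (ι i), gf i, Bc i, Bf i, pair i⟩ : PairedInstance)) Kop)
    (Zf : ∀ i, (Bf i).Cfg → Matrix (B4.Idx (pbox (TGIndex.Mn d hL (ι i))) (d + 1)) (B4.Idx (pbox (TGIndex.Mn d hL (ι i))) (d + 1)) ℝ)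
    (Zc : ∀ i, (Bc i).Cfg → Matrix (B4.Idx (pbox (TGIndex.Mn d hL (ι i))) (d + 1)) (B4.Idx (pbox (TGIndex.Mn d hL (ι i))) (d + 1)) ℝ)
    {θZ : ℝ} (hθL : (L : ℝ)⁻¹ ≤ θZ) (hθ1 : θZ < 1)
    (hZ : ∃ δZ ζ τ a₁ : ℝ, 0 < δZ ∧ 0 < ζ ∧ 0 < τ ∧ 0 < a₁ ∧
      ∀ (i : I) (α₀ : ℝ), 0 < α₀ → α₀ ≤ a₁ → ∀ U : (Bf i).Cfg, (Bf i).Reg335 c35 α₀ U →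
        (∀ p q : B4.Idx (pbox (TGIndex.Mn d hL (ι i))) (d + 1),
            |Zc i ((pair i).avg U) p q| ≤ ζ * α₀ * Real.exp (-(δZ * pdist (TGIndex.Mn d hL (ι i)) (one_le_M _) (p.1 : Fin (d + 1) → ℤ) (q.1 : Fin (d + 1) → ℤ)))) ∧
        (∀ p q : B4.Idx (pbox (TGIndex.Mn d hL (ι i))) (d + 1),
            |Zf i U p q| ≤ ζ * α₀ * Real.exp (-(δZ * pdist (TGIndex.Mn d hL (ι i)) (one_le_M _) (p.1 : Fin (d + 1) → ℤ) (q.1 : Fin (d + 1) → ℤ)))) ∧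
        (∀ p q : B4.Idx (pbox (TGIndex.Mn d hL (ι i))) (d + 1),
            |Zf i U p q - Zc i ((pair i).avg U) p q| ≤ τ * θZ ^ (ι i).k * Real.exp (-(δZ * pdist (TGIndex.Mn d hL (ι i)) (one_le_M _) (p.1 : Fin (d + 1) → ℤ) (q.1 : Fin (d + 1) → ℤ)))))
    (Pf : ∀ i, (Bf i).Cfg → Matrix (Idx (TGIndex.Mn d hL (ι i))) (Idx (TGIndex.Mn d hL (ι i))) ℝ)
    (Pc : ∀ i, (Bc i).Cfg → Matrix (Idx (TGIndex.Mn d hL (ι i))) (Idx (TGIndex.Mn d hL (ι i))) ℝ) {γP : ℝ} (hγP : 0 < γP)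
    (hP : ∃ δP ζ τ a₁ : ℝ, 0 < δP ∧ 0 < ζ ∧ 0 < τ ∧ 0 < a₁ ∧
      ∀ (i : I) (α₀ : ℝ), 0 < α₀ → α₀ ≤ a₁ → ∀ U : (Bf i).Cfg, (Bf i).Reg335 c35 α₀ U →
        (∀ p q : Idx (TGIndex.Mn d hL (ι i)), |Pc i ((pair i).avg U) p q| ≤ ζ * α₀ * Real.exp (-(δP * tdist (TGIndex.Mn d hL (ι i)) p q))) ∧
        (∀ p q : Idx (TGIndex.Mn d hL (ι i)), |Pf i U p q| ≤ ζ * α₀ * Real.exp (-(δP * tdist (TGIndex.Mn d hL (ι i)) p q))) ∧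
        (∀ p q : Idx (TGIndex.Mn d hL (ι i)), |Pf i U p q - Pc i ((pair i).avg U) p q|
            ≤ τ * ((L : ℝ) ^ (ι i).k) ^ (-γP) * Real.exp (-(δP * tdist (TGIndex.Mn d hL (ι i)) p q))))
    (ne2At : ∀ {F : T4Family} {D : Datum F N}, key F D → (ℕ → ℝ) → List (ULoop F) → ℕ → NE2Objects₁₁) (RRec : RateRecordPred N)
    (hadm : ∀ (F : T4Family) (D : Datum F N) (g₀ : ℕ → ℝ) (os : List (ULoop F)) (R : RateCarriers N), RRec F D g₀ os R →
      ∃ (h : key F D) (k : ℕ), R.ne2 = ne2OfRecord₁₁ (ne2At h g₀ os k))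
    (h : ∀ (F : T4Family) (D : Datum F N) (h : key F D) (g₀ : ℕ → ℝ) (os : List (ULoop F)) (k : ℕ),
      ne2At h g₀ os k = ⟨I, c35, p, fun i => ⟨tgGeoC d hL (ι i), gf i, Bc i, Bf i, pair i⟩, Kop, tgSiteExOn ι gf Bc Bf d hL aS pair Pf Pc,
        tgCovExOn ι gf Bc Bf d hL b α β pair Zf Zc, fun _ _ => True, fun i => (tgGeoC d hL (ι i)).dist⟩) :
    S_N15 RRec := by
  refine s_N15_of_admits ne2At RRec hadm fun F D hk g₀ os k => ?_
  rw [h F D hk g₀ os k]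
  exact n15At_tgExEx_of_ne2PlusOperator (d := d) ι gf Bc Bf hd hLodd hL2 hL hb haS α β hι hM pair p Kop hop Zf Zc hθL hθ1 hZ Pf Pc hγP hP

end Home

end Summit.QuantumFields.YangMills.BalabanUVNodes.N15.SiteLayerBg

end
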